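import Summits.NavierStokesRegularity.FunctionalMining.Candidates
import Literature.Analysis.FluidPDE.TorusNSPressureGradientBudget
import Literature.Analysis.FluidPDE.TorusPressurePoisson
import Literature.Analysis.FunctionSpaces.TorusInverseLaplacianCalculus
import HarnessLib

/-!
# FunctionalMining — the zero-mean pressure of a velocity field and the pressure moments `∫|p|^q`

Search for candidate a priori estimates; no regularity claim. Cell `pub-nsfunc`, prove seat
(gen 10). The K0 family `EP.p.q` (pressure moments `∫|p|^q`, DICTIONARY P1 rows `EP.p.q=2, 3`) needs
the pressure as a functional OF THE VELOCITY FIELD: for a velocity field `v` on `T^d` put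
`s_v := ∑ᵢⱼ (∂ᵢv)ⱼ(∂ⱼv)ᵢ = tr((∇v)²)` and

`π_v := Δ⁻¹(−s_v)` (`pressureOf v`; the tree's honest inverse Laplacian `Torus.invLaplacian`),

the zero-mean solution of the pressure Poisson equation `Δπ = −s_v` (`= −∂ᵢ∂ⱼ(vᵢvⱼ)` for
divergence-free `v`). Along a classical solution `(u, p)` of the unforced Navier–Stokes equations on
`T^d × [a, b]` the tree's Poisson identity `Δp = −∑ᵢⱼ∂ᵢuⱼ∂ⱼuᵢ`
(`Torus.classicalNS_laplacian_pressure_eq_neg_sum`) and `Δ⁻¹Δh = h` for zero-mean `h` give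
`π_{u(t)} = p(t) − ∫p(t)` (`pressureOf_eq_pressure_sub_integral`): the solution's pressure,
normalised. The row functional is `torusPressureMoment q v := ∫ |π_v|^q` (real power).

Packaging definitions (objects the row posits) + elementary facts; nothing about regularity.

## Main statements

* `gradSqTrace`, `pressureOf`, `torusPressureMoment` — definitions;
* `isSmooth_pressureOf`, `integral_pressureOf` — `π_v` is smooth with zero mean;
* `pressureOf_eq_pressure_sub_integral` — along classical unforced solutions `π_{u t} = p t − ∫p t`.
-/

noncomputable section

open MeasureTheory Finset Set Filter Topology
open scoped InnerProductSpace RealInnerProductSpace ContDiff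

namespace Summit.NavierStokesRegularity.FunctionalMining

open Literature.Analysis.FunctionSpaces Literature.Analysis.FluidPDE

variable {d : Type*} [Fintype d] [DecidableEq d]

/-! ## 1. Definitions -/

/-- `s_v(x) := ∑ᵢⱼ (∂ᵢv)ⱼ(x) (∂ⱼv)ᵢ(x) = tr((∇v(x))²)`, the source of the pressure Poisson equation
`Δp = −s_u` along Navier–Stokes (`= ∂ᵢ∂ⱼ(uᵢuⱼ)` for `div u = 0`). [folklore] -/
def gradSqTrace (v : UnitAddTorus d → EuclideanSpace ℝ d) (x : UnitAddTorus d) : ℝ :=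
  ∑ i, ∑ j, Torus.partialDeriv i v x j * Torus.partialDeriv j v x i

/-- **The zero-mean pressure of a velocity field**: `π_v := Δ⁻¹(−s_v)` (`Torus.invLaplacian`), the
zero-mean solution of `Δπ = −∑ᵢⱼ(∂ᵢv)ⱼ(∂ⱼv)ᵢ` for smooth divergence-free `v`. Search for candidate
a priori estimates; no regularity claim. [ours; packaging] -/
def pressureOf (v : UnitAddTorus d → EuclideanSpace ℝ d) : UnitAddTorus d → ℝ :=
  Torus.invLaplacian (fun x => -gradSqTrace v x)

/-- **K0 family `EP.p.q`: the pressure moment `∫_{T^d} |π_v|^q`** (real power; `π_v = pressureOf v`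
the zero-mean pressure). Search for candidate a priori estimates; no regularity claim.
[ours; packaging] -/
def torusPressureMoment (q : ℝ) (v : UnitAddTorus d → EuclideanSpace ℝ d) : ℝ :=
  ∫ x, |pressureOf v x| ^ q

/-! ## 2. Elementary facts -/

/-- `s_v` is smooth for smooth `v`. [folklore] -/
theorem isSmooth_gradSqTrace {v : UnitAddTorus d → EuclideanSpace ℝ d} (hv : Torus.IsSmooth v) :
    Torus.IsSmooth (gradSqTrace v) :=
  ContDiff.sum fun i _ => ContDiff.sum fun j _ =>
    ((hv.partialDeriv i).apply j).mul ((hv.partialDeriv j).apply i)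

/-- `−s_v` is smooth for smooth `v`. [folklore] -/
theorem isSmooth_neg_gradSqTrace {v : UnitAddTorus d → EuclideanSpace ℝ d} (hv : Torus.IsSmooth v) :
    Torus.IsSmooth (fun x => -gradSqTrace v x) :=
  (isSmooth_gradSqTrace hv).neg

/-- `π_v` is smooth for smooth `v`. [folklore] -/
theorem isSmooth_pressureOf {v : UnitAddTorus d → EuclideanSpace ℝ d} (hv : Torus.IsSmooth v) :
    Torus.IsSmooth (pressureOf v) :=
  Torus.isSmooth_invLaplacian (isSmooth_neg_gradSqTrace hv)

/-- `π_v` has zero mean. [folklore] -/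
theorem integral_pressureOf [Nonempty d] {v : UnitAddTorus d → EuclideanSpace ℝ d}
    (hv : Torus.IsSmooth v) : ∫ x, pressureOf v x = 0 :=
  Torus.integral_invLaplacian (isSmooth_neg_gradSqTrace hv)

/-- `∫|π_v|^q ≥ 0`. [folklore] -/
theorem torusPressureMoment_nonneg (q : ℝ) (v : UnitAddTorus d → EuclideanSpace ℝ d) :
    0 ≤ torusPressureMoment q v :=
  integral_nonneg fun _ => Real.rpow_nonneg (abs_nonneg _) _

/-- The pressure moment at `q = 2` is `∫ π_v²`. [folklore] -/
theorem torusPressureMoment_two (v : UnitAddTorus d → EuclideanSpace ℝ d) :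
    torusPressureMoment 2 v = ∫ x, pressureOf v x ^ 2 := by
  unfold torusPressureMoment
  refine integral_congr_ae (ae_of_all _ fun x => ?_)
  show |pressureOf v x| ^ (2 : ℝ) = pressureOf v x ^ 2
  rw [Real.rpow_two, sq_abs]

/-! ## 3. Along classical solutions the functional is the normalised pressure -/

/-- **`π_{u(t)} = p(t) − ∫p(t)` along classical unforced solutions on `T^d`.** The solution's
pressure solves `Δp = −∑ᵢⱼ∂ᵢuⱼ∂ⱼuᵢ` (tree, Majda–Bertozzi (1.84)); subtracting its mean does not
change the Laplacian, and `Δ⁻¹Δh = h` for smooth zero-mean `h`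
(`Torus.invLaplacian_laplacian_of_integral_eq_zero`). [folklore] -/
theorem pressureOf_eq_pressure_sub_integral [Nonempty d] {a b ν : ℝ}
    {u : ℝ → UnitAddTorus d → EuclideanSpace ℝ d} {p : ℝ → UnitAddTorus d → ℝ}
    (h : Torus.IsClassicalNSSolutionOn (Icc a b) ν 0 u p) (hab : a < b) {t : ℝ} (ht : t ∈ Icc a b) :
    pressureOf (u t) = fun x => p t x - ∫ y, p t y := by
  have hpt : Torus.IsSmooth (p t) := h.smooth_pressure.isSmooth_slice ht
  have hg : Torus.IsSmooth (fun x => p t x - ∫ y, p t y) := hpt.sub contDiff_const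
  have hΔ : (fun x => -gradSqTrace (u t) x) = Torus.laplacian (fun x => p t x - ∫ y, p t y) := by
    funext x
    rw [Torus.laplacian_sub_const_apply hpt, Torus.classicalNS_laplacian_pressure_eq_neg_sum hab h ht x]
    rfl
  have h0 : ∫ x, (p t x - ∫ y, p t y) = 0 := by
    rw [integral_sub hpt.continuous.integrable_unitAddTorus (integrable_const _), integral_const,
      smul_eq_mul, probReal_univ, one_mul, sub_self]
  rw [pressureOf, hΔ, Torus.invLaplacian_laplacian_of_integral_eq_zero hg h0]

/-- Hence, along classical unforced solutions, the row functional is the `q`-th moment of the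
normalised pressure: `torusPressureMoment q (u t) = ∫|p t − ∫p t|^q`. [folklore] -/
theorem torusPressureMoment_eq_of_solution [Nonempty d] {a b ν : ℝ}
    {u : ℝ → UnitAddTorus d → EuclideanSpace ℝ d} {p : ℝ → UnitAddTorus d → ℝ}
    (h : Torus.IsClassicalNSSolutionOn (Icc a b) ν 0 u p) (hab : a < b) {t : ℝ} (ht : t ∈ Icc a b)
    (q : ℝ) : torusPressureMoment q (u t) = ∫ x, |p t x - ∫ y, p t y| ^ q := by
  rw [torusPressureMoment, pressureOf_eq_pressure_sub_integral h hab ht]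

end Summit.NavierStokesRegularity.FunctionalMining
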